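import Mathlib

/-!
# Stub `stub_truncate` — crux `WordLengthQP` (stmt-ValiantsHypothesis-6623), line `Sketch`

Crux `Summit.ValiantsHypothesis.ValiantsHypothesis.Theses.ElementaryWordLength.WordLengthQP`,
route `ElementaryWordLength`, line `Sketch` (ε-order ladder), stub `stub_truncate`
(de-bordering, step 1).

Truncating every `ℂ[ε]`-coefficient `a`, `b` of every S-affine letter (`C b` or
`C a * X v + C b`) modulo `ε^(q+1)` changes each letter by `C (ε^(q+1)) • r`, hence the product
of the letters by `C (ε^(q+1)) • R`, so the border equation
`(0,0)` entry `= C (ε^q) * map C f + C (ε^(q+1)) * G` survives with a new `G`, while all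
coefficients now have `ε`-degree `≤ q`.  Here `ε = Polynomial.X` and the `x̄`-variables are
`MvPolynomial.X v`.
-/

-- `Summit.ValiantsHypothesis.ValiantsHypothesis.…` is the tree's mandated single-conjunct layout
-- (Sub = Summit), so the duplicated namespace component is intended.
set_option linter.dupNamespace false

open MvPolynomial

namespace Summit.ValiantsHypothesis.ValiantsHypothesis.Cruxes.WordLengthQP.EpsOrderLadder

/-- The remainder of a polynomial modulo `X^(q+1)` has `natDegree ≤ q`. -/
theorem truncate_natDegree_modByMonic_le (q : ℕ) (p : Polynomial ℂ) :
    (p %ₘ (Polynomial.X ^ (q + 1))).natDegree ≤ q := by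
  have h := Polynomial.natDegree_modByMonic_lt p (Polynomial.monic_X_pow (q + 1)) (by
    intro h1
    have h2 := congrArg Polynomial.natDegree h1
    simp at h2)
  rw [Polynomial.natDegree_X_pow] at h
  omega

/-- Division with remainder by `X^(q+1)`: `p = p %ₘ X^(q+1) + X^(q+1) * (p /ₘ X^(q+1))`. -/
theorem truncate_decomp (q : ℕ) (p : Polynomial ℂ) :
    p = p %ₘ (Polynomial.X ^ (q + 1)) +
      Polynomial.X ^ (q + 1) * (p /ₘ (Polynomial.X ^ (q + 1))) :=
  (Polynomial.modByMonic_add_div p (Polynomial.X ^ (q + 1))).symm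

/-- Every S-affine entry `x` splits as a truncated S-affine entry `e` (coefficients of
`ε`-degree `≤ q`) plus `C (X^(q+1)) * r`. -/
theorem truncate_entry {σ : Type} (q : ℕ) (x : MvPolynomial σ (Polynomial ℂ))
    (hx : (∃ b : Polynomial ℂ, x = MvPolynomial.C b) ∨
      (∃ (a b : Polynomial ℂ) (v : σ),
        x = MvPolynomial.C a * MvPolynomial.X v + MvPolynomial.C b)) :
    ∃ e r : MvPolynomial σ (Polynomial ℂ),
      ((∃ b : Polynomial ℂ, b.natDegree ≤ q ∧ e = MvPolynomial.C b) ∨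
        (∃ (a b : Polynomial ℂ) (v : σ), a.natDegree ≤ q ∧ b.natDegree ≤ q ∧
          e = MvPolynomial.C a * MvPolynomial.X v + MvPolynomial.C b)) ∧
      x = e + MvPolynomial.C (Polynomial.X ^ (q + 1)) * r := by
  have hC : ∀ p : Polynomial ℂ, (C p : MvPolynomial σ (Polynomial ℂ)) =
      C (p %ₘ (Polynomial.X ^ (q + 1))) +
        C (Polynomial.X ^ (q + 1)) * C (p /ₘ (Polynomial.X ^ (q + 1))) := by
    intro p
    rw [← C_mul, ← C_add, ← truncate_decomp q p]
  rcases hx with ⟨b, rfl⟩ | ⟨a, b, v, rfl⟩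
  · exact ⟨C (b %ₘ (Polynomial.X ^ (q + 1))), C (b /ₘ (Polynomial.X ^ (q + 1))),
      Or.inl ⟨_, truncate_natDegree_modByMonic_le q b, rfl⟩, hC b⟩
  · refine ⟨C (a %ₘ (Polynomial.X ^ (q + 1))) * X v + C (b %ₘ (Polynomial.X ^ (q + 1))),
      C (a /ₘ (Polynomial.X ^ (q + 1))) * X v + C (b /ₘ (Polynomial.X ^ (q + 1))),
      Or.inr ⟨_, _, v, truncate_natDegree_modByMonic_le q a,
        truncate_natDegree_modByMonic_le q b, rfl⟩, ?_⟩
    linear_combination (X v) * hC a + hC b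

/-- Every S-affine letter `m` splits as a truncated S-affine letter `m'` plus
`C (X^(q+1)) • r`. -/
theorem truncate_letter {σ : Type} (q : ℕ)
    (m : Matrix (Fin 2) (Fin 2) (MvPolynomial σ (Polynomial ℂ)))
    (hm : ∀ i j : Fin 2, (∃ b : Polynomial ℂ, m i j = MvPolynomial.C b) ∨
      (∃ (a b : Polynomial ℂ) (v : σ),
        m i j = MvPolynomial.C a * MvPolynomial.X v + MvPolynomial.C b)) :
    ∃ m' r : Matrix (Fin 2) (Fin 2) (MvPolynomial σ (Polynomial ℂ)),
      (∀ i j : Fin 2,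
        (∃ b : Polynomial ℂ, b.natDegree ≤ q ∧ m' i j = MvPolynomial.C b) ∨
        (∃ (a b : Polynomial ℂ) (v : σ), a.natDegree ≤ q ∧ b.natDegree ≤ q ∧
          m' i j = MvPolynomial.C a * MvPolynomial.X v + MvPolynomial.C b)) ∧
      m = m' +
        (MvPolynomial.C (Polynomial.X ^ (q + 1)) : MvPolynomial σ (Polynomial ℂ)) • r := by
  have h := fun i j => truncate_entry q (m i j) (hm i j)
  choose e r he hx using h
  refine ⟨Matrix.of e, Matrix.of r, fun i j => he i j, Matrix.ext fun i j => ?_⟩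
  simp only [Matrix.add_apply, Matrix.smul_apply, Matrix.of_apply, smul_eq_mul]
  exact hx i j

/-- Truncating all letters of a program: same length, truncated S-affine letters, and the
product changes by `C (X^(q+1)) • R`. -/
theorem truncate_list {σ : Type} (q : ℕ)
    (ms : List (Matrix (Fin 2) (Fin 2) (MvPolynomial σ (Polynomial ℂ))))
    (hS : ∀ m ∈ ms, ∀ i j : Fin 2, (∃ b : Polynomial ℂ, m i j = MvPolynomial.C b) ∨
      (∃ (a b : Polynomial ℂ) (v : σ),
        m i j = MvPolynomial.C a * MvPolynomial.X v + MvPolynomial.C b)) :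
    ∃ ms' : List (Matrix (Fin 2) (Fin 2) (MvPolynomial σ (Polynomial ℂ))),
      ms'.length = ms.length ∧
      (∀ m ∈ ms', ∀ i j : Fin 2,
        (∃ b : Polynomial ℂ, b.natDegree ≤ q ∧ m i j = MvPolynomial.C b) ∨
        (∃ (a b : Polynomial ℂ) (v : σ), a.natDegree ≤ q ∧ b.natDegree ≤ q ∧
          m i j = MvPolynomial.C a * MvPolynomial.X v + MvPolynomial.C b)) ∧
      ∃ R : Matrix (Fin 2) (Fin 2) (MvPolynomial σ (Polynomial ℂ)),
        ms.prod = ms'.prod +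
          (MvPolynomial.C (Polynomial.X ^ (q + 1)) : MvPolynomial σ (Polynomial ℂ)) • R := by
  induction ms with
  | nil => exact ⟨[], rfl, fun m hm => absurd hm (by simp), 0, by simp⟩
  | cons m ms ih =>
    obtain ⟨ms', hlen, hS', R, hR⟩ := ih (fun m' hm' => hS m' (List.mem_cons_of_mem m hm'))
    obtain ⟨m', r, hm', hmr⟩ := truncate_letter q m (hS m List.mem_cons_self)
    refine ⟨m' :: ms', by simp [hlen], ?_,
      m' * R + r * ms'.prod +
        (MvPolynomial.C (Polynomial.X ^ (q + 1)) : MvPolynomial σ (Polynomial ℂ)) • (r * R),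
      ?_⟩
    · intro x hx i j
      rcases List.mem_cons.mp hx with rfl | hx
      · exact hm' i j
      · exact hS' x hx i j
    · rw [List.prod_cons, List.prod_cons, hmr, hR]
      simp only [Matrix.add_mul, Matrix.mul_add, Matrix.smul_mul, Matrix.mul_smul, smul_add,
        smul_smul]
      abel

/-- **stub_truncate** (de-bordering, step 1): reducing every `ℂ[ε]`-coefficient of the letters
modulo `ε^(q+1)` does not change the product modulo `ε^(q+1)`, so the border equation
`(0,0)` entry `= ε^q · f + ε^(q+1) · G` survives with a new `G`, and all coefficients now have
`ε`-degree `≤ q`. [folklore] -/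
theorem stub_truncate {σ : Type} (q : ℕ) (f : MvPolynomial σ ℂ)
    (ms : List (Matrix (Fin 2) (Fin 2) (MvPolynomial σ (Polynomial ℂ))))
    (hS : ∀ m ∈ ms, ∀ i j : Fin 2, (∃ b : Polynomial ℂ, m i j = MvPolynomial.C b) ∨
      (∃ (a b : Polynomial ℂ) (v : σ),
        m i j = MvPolynomial.C a * MvPolynomial.X v + MvPolynomial.C b))
    (hF : ∃ G : MvPolynomial σ (Polynomial ℂ), ms.prod 0 0 =
      MvPolynomial.C (Polynomial.X ^ q) * MvPolynomial.map Polynomial.C f +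
        MvPolynomial.C (Polynomial.X ^ (q + 1)) * G) :
    ∃ ms' : List (Matrix (Fin 2) (Fin 2) (MvPolynomial σ (Polynomial ℂ))),
      ms'.length = ms.length ∧
      (∀ m ∈ ms', ∀ i j : Fin 2,
        (∃ b : Polynomial ℂ, b.natDegree ≤ q ∧ m i j = MvPolynomial.C b) ∨
        (∃ (a b : Polynomial ℂ) (v : σ), a.natDegree ≤ q ∧ b.natDegree ≤ q ∧
          m i j = MvPolynomial.C a * MvPolynomial.X v + MvPolynomial.C b)) ∧
      ∃ G : MvPolynomial σ (Polynomial ℂ), ms'.prod 0 0 =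
        MvPolynomial.C (Polynomial.X ^ q) * MvPolynomial.map Polynomial.C f +
          MvPolynomial.C (Polynomial.X ^ (q + 1)) * G := by
  obtain ⟨ms', hlen, hS', R, hR⟩ := truncate_list q ms hS
  obtain ⟨G, hG⟩ := hF
  refine ⟨ms', hlen, hS', G - R 0 0, ?_⟩
  have h00 := congrFun (congrFun hR 0) 0
  simp only [Matrix.add_apply, Matrix.smul_apply, smul_eq_mul] at h00
  linear_combination hG - h00

end Summit.ValiantsHypothesis.ValiantsHypothesis.Cruxes.WordLengthQP.EpsOrderLadder
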